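/-
Copyright: the b2b-balaban T⁴-continuum CRUX team, row NE7b OWNER lineage `t4-ne7b-p1` (gen 136). Project licence.
-/
import Summits.QuantumFields.BalabanUV.T4Continuum.Spine.NE7b.SupEffectiveActionHessian
import Summits.QuantumFields.BalabanUV.T4Continuum.Spine.NE7b.SupBlockEffectiveActionDerivative

/-!
# THE EFFECTIVE ACTION OF A BLOCK-LOCAL INPUT IS TWICE DIFFERENTIABLE — (319)'s BLOCK TWIN, (d8′)(1)'s FIRST HALF: for a `C²` block
# potential `U : ℝ^ι → ℝ` (`HasFDerivAt U (U′ φ) φ`, `HasFDerivAt U′ (U″ φ) φ`, `U″` continuous) with the THREE block letters — stability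
# `−κ₀Σ_Yφ² ≤ U`, gradient `‖U′(φ)‖ ≤ κ₁(a+Σ_Yφ²)`, Hessian `‖U″(φ)‖ ≤ κ₂` — over `N(0,Γ)`, `Γ ⪯ γ_op·1`, under the regulator margin
# `(2κ₀(1+τ)+4δ)γ_op ≤ θ < 1`, at EVERY `ψ₀` the gradient map `ψ ↦ D(−log Z)(ψ)` of (399) is Fréchet differentiable with derivative
#   `Z⁻¹ • ∫e^{−U(ω+ψ₀)}•(U″(ω+ψ₀) − U′(ω+ψ₀)⊗U′(ω+ψ₀))dN(0,Γ) + (Z⁻²•G)⊗G`,  `G = ∫e^{−U}•U′`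
# — the HESSIAN of the next potential of a block input, by a second dominated differentiation and the quotient rule ((319) re-run on the
# block letters); the covariance formula and the matrix letters ((320)∕(388)'s twins) are the successor's (row NE7b, node U5c; (319)∕(399) BY
# NAME; [folklore])

Cell `pub-balaban`, sub-cell `t4`, spine estimate NE7b (`T4WeightBudget.RelWeightBound`; the cell's OWN estimate — NOT PRINTED in
[Bałaban 1983–89], NOT PROVED).  Crux-route work under `Spine/NE7b/` by the row OWNER (`t4-ne7b-p1` gen 136, file (402)) under FREEZE
(0)'s crux-prover clause, on this gen's SCOPING-d8 DECISION (d8′)(1); NOTHING of Bałaban's is named as a Lean object, valued or asserted; no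
`T4Continuum/Support` leaf typed; no `def`, no notation; zero `sorry`.  Imports (BY NAME): the OWNER's (319) `…SupEffectiveActionHessian`
(`eight_sq_le`, (313)'s `sum_sq_ball_le`, `integrable_domination`), (399) `…SupBlockEffectiveActionDerivative` (`block_domination`,
`hasFDerivAt_block_neg_log`, `integrable_weighted_blockDeriv`, `integrable_exp_neg_block`, `neg_block_le`); Mathlib's
`hasFDerivAt_integral_of_dominated_of_fderiv_le`.

WHAT IS PROVED ([folklore]; `Z(ψ) = ∫e^{−U(ω+ψ)}dN(0,Γ)`, `G(ψ) = ∫e^{−U(ω+ψ)}•U′(ω+ψ)`):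
* §1 `hasFDerivAt_weightedBlockDeriv` (product rule: `d_ψ(e^{−U(ω+ψ)}•U′(ω+ψ)) = e^{−U}•(U″ − U′⊗U′)`), **`block_second_domination`** (on
  `‖ψ−ψ₀‖ ≤ 1`: `‖e^{−U}•(U″ − U′⊗U′)‖ ≤ e^{κ₀(1+τ⁻¹)M}(κ₂ + κ₁²(2(a+2M)² + 4δ⁻²))·e^{½(2κ₀(1+τ)+4δ)Σ_Yω²}`, `M = 2Σ_Yψ₀²+2`);
* §2 `hasFDerivAt_block_step` (`d_ψZ = −G`), **`hasFDerivAt_block_tiltedNumerator`** (`d_ψG = ∫e^{−U}•(U″ − U′⊗U′)`), THE END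
  **`hasFDerivAt_fderiv_block_neg_log`**; §3 toy.

HONEST (what this is NOT).  The Hessian as a derivative; its covariance reading, letters and the cubic column for block inputs remain; the three
block letters are hypotheses; scalar skeleton ((A3), NC-NE7b-α UNRULED); nothing of Bałaban's asserted.  BY-NAME EFFECT ON THE WALL: NONE.  NE7b
NOT PRINTED ∕ NOT PROVED; spine PROVED 0∕9; rung (B)+1 — the programme's measures remain FINITE-torus statements; NOT the mass gap, NOT Clay.
HONEST DEPENDENCY: continuum YM on T⁴ ⇐ BetaPertH ∧ nine spine estimates (0∕9 proved); BetaPertH ⇐ (D1) ∧ (D4) ∧ CAP+tail; G-an2-4 gates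
asym, D1 and NE2∕3∕4.
-/

set_option autoImplicit false
set_option maxSynthPendingDepth 2

noncomputable section

namespace Summit.QuantumFields.BalabanUV.T4Continuum.NE7b.SupBlockEffectiveActionHessian

open MeasureTheory ProbabilityTheory Finset Real Metric Filter
open scoped BigOperators Topology
open SupEffectiveActionHessian (eight_sq_le)
open SupEffectiveActionDerivative (sum_sq_ball_le integrable_domination mul_opBound_le_of_le)
open SupBlockEffectiveActionDerivative (block_domination hasFDerivAt_block_neg_log integrable_weighted_blockDeriv integrable_exp_neg_block
  neg_block_le)
open LogConcaveMarginalDeriv (hasFDerivAt_fibreIntegral)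

variable {ι : Type} [Fintype ι] [DecidableEq ι]

/-! ## §1. The product rule and the second domination -/

omit [DecidableEq ι] in
/-- **THE PRODUCT RULE**: `U ∈ C²` ⟹ at every `ψ, ω`, `d_ψ(e^{−U(ω+ψ)}•U′(ω+ψ)) = e^{−U(ω+ψ)}•(U″(ω+ψ) − U′(ω+ψ)⊗U′(ω+ψ))`. [folklore] -/
theorem hasFDerivAt_weightedBlockDeriv {U : EuclideanSpace ℝ ι → ℝ} {U' : EuclideanSpace ℝ ι → EuclideanSpace ℝ ι →L[ℝ] ℝ}
    {U'' : EuclideanSpace ℝ ι → EuclideanSpace ℝ ι →L[ℝ] EuclideanSpace ℝ ι →L[ℝ] ℝ}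
    (hUd : ∀ φ, HasFDerivAt U (U' φ) φ) (hU'd : ∀ φ, HasFDerivAt U' (U'' φ) φ) (ω ψ : EuclideanSpace ℝ ι) :
    HasFDerivAt (fun ψ' : EuclideanSpace ℝ ι => exp (-U (ω + ψ')) • U' (ω + ψ'))
      (exp (-U (ω + ψ)) • (U'' (ω + ψ) - (U' (ω + ψ)).smulRight (U' (ω + ψ)))) ψ := by
  have hlin : HasFDerivAt (fun ψ' : EuclideanSpace ℝ ι => ω + ψ') (ContinuousLinearMap.id ℝ (EuclideanSpace ℝ ι)) ψ :=
    (hasFDerivAt_id ψ).const_add ω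
  have hU : HasFDerivAt (fun ψ' : EuclideanSpace ℝ ι => U (ω + ψ')) (U' (ω + ψ)) ψ := by
    have h := (hUd (ω + ψ)).comp ψ hlin
    rw [ContinuousLinearMap.comp_id] at h
    exact h
  have hU1 : HasFDerivAt (fun ψ' : EuclideanSpace ℝ ι => U' (ω + ψ')) (U'' (ω + ψ)) ψ := by
    have h := (hU'd (ω + ψ)).comp ψ hlin
    rw [ContinuousLinearMap.comp_id] at h
    exact h
  have hE := hU.fun_neg.exp
  refine (hE.smul hU1).congr_fderiv ?_
  ext h k
  simp only [_root_.add_apply, _root_.sub_apply, ContinuousLinearMap.smulRight_apply, _root_.smul_apply, _root_.neg_apply,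
    smul_eq_mul]
  ring

omit [DecidableEq ι] in
/-- **THE SECOND BLOCK DOMINATION**: stability (`κ₀ ≥ 0`), gradient letter (`κ₁, a ≥ 0`), Hessian letter `‖U″(φ)‖ ≤ κ₂`, `0 < τ`, `0 < δ`;
for `‖ψ − ψ₀‖ ≤ 1` and every `ω`, with `M = 2Σ_Yψ₀² + 2`:
`‖e^{−U(ω+ψ)}•(U″(ω+ψ) − U′(ω+ψ)⊗U′(ω+ψ))‖ ≤ e^{κ₀(1+τ⁻¹)M}(κ₂ + κ₁²(2(a+2M)² + 4(δ²)⁻¹))·e^{½(2κ₀(1+τ)+4δ)Σ_Yω²}`. [folklore] -/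
theorem block_second_domination (Y : Finset ι) {U : EuclideanSpace ℝ ι → ℝ} {U' : EuclideanSpace ℝ ι → EuclideanSpace ℝ ι →L[ℝ] ℝ}
    {U'' : EuclideanSpace ℝ ι → EuclideanSpace ℝ ι →L[ℝ] EuclideanSpace ℝ ι →L[ℝ] ℝ} {κ₀ κ₁ κ₂ a τ δ : ℝ}
    (hκ₀ : 0 ≤ κ₀) (hκ₁ : 0 ≤ κ₁) (ha : 0 ≤ a) (hκ₂ : 0 ≤ κ₂) (hτ : 0 < τ) (hδ : 0 < δ)
    (hstab : ∀ φ : EuclideanSpace ℝ ι, -(κ₀ * ∑ x ∈ Y, φ x ^ 2) ≤ U φ)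
    (hU'b : ∀ φ : EuclideanSpace ℝ ι, ‖U' φ‖ ≤ κ₁ * (a + ∑ x ∈ Y, φ x ^ 2)) (hU''b : ∀ φ : EuclideanSpace ℝ ι, ‖U'' φ‖ ≤ κ₂)
    (ψ₀ ψ : EuclideanSpace ℝ ι) (hψ : ‖ψ - ψ₀‖ ≤ 1) (ω : EuclideanSpace ℝ ι) :
    ‖exp (-U (ω + ψ)) • (U'' (ω + ψ) - (U' (ω + ψ)).smulRight (U' (ω + ψ)))‖ ≤
      exp (κ₀ * (1 + τ⁻¹) * (2 * ∑ x ∈ Y, ψ₀ x ^ 2 + 2)) *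
        (κ₂ + κ₁ ^ 2 * (2 * (a + 2 * (2 * ∑ x ∈ Y, ψ₀ x ^ 2 + 2)) ^ 2 + 4 * (δ ^ 2)⁻¹)) *
        exp ((2 * κ₀ * (1 + τ) + 4 * δ) * (∑ x ∈ Y, ω x ^ 2) / 2) := by
  set M : ℝ := 2 * ∑ x ∈ Y, ψ₀ x ^ 2 + 2 with hM
  set Sω : ℝ := ∑ x ∈ Y, ω x ^ 2 with hSω
  have hSω0 : 0 ≤ Sω := sum_nonneg fun x _ => sq_nonneg _
  have hM0 : 0 ≤ M := by rw [hM]; positivity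
  have hψM : ∑ x ∈ Y, ψ x ^ 2 ≤ M := sum_sq_ball_le Y hψ
  -- the exponent: stability + Young
  have hV : -U (ω + ψ) ≤ κ₀ * (1 + τ) * Sω + κ₀ * (1 + τ⁻¹) * M := by
    have h := neg_block_le Y hκ₀ hτ hstab ω ψ
    have h2 : κ₀ * (1 + τ⁻¹) * ∑ x ∈ Y, ψ x ^ 2 ≤ κ₀ * (1 + τ⁻¹) * M := mul_le_mul_of_nonneg_left hψM (by positivity)
    linarith
  -- the first derivative, squared
  have hsum : ∑ x ∈ Y, (ω + ψ) x ^ 2 ≤ 2 * Sω + 2 * M := by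
    have h := SupRegulatedActivityShift.sum_add_sq_le Y (fun x => ω x) (fun x => ψ x) one_pos
    have e : ∑ x ∈ Y, (ω + ψ) x ^ 2 = ∑ x ∈ Y, (ω x + ψ x) ^ 2 := sum_congr rfl fun x _ => by simp
    rw [e]
    norm_num at h
    linarith
  have hD : ‖U' (ω + ψ)‖ ≤ κ₁ * (a + 2 * M + 2 * Sω) := by
    refine (hU'b (ω + ψ)).trans (mul_le_mul_of_nonneg_left ?_ hκ₁)
    linarith
  have hD0 : 0 ≤ κ₁ * (a + 2 * M + 2 * Sω) := by positivity
  have hDD : ‖(U' (ω + ψ)).smulRight (U' (ω + ψ))‖ ≤ κ₁ ^ 2 * (a + 2 * M + 2 * Sω) ^ 2 := by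
    rw [ContinuousLinearMap.norm_smulRight_apply]
    calc _ ≤ κ₁ * (a + 2 * M + 2 * Sω) * (κ₁ * (a + 2 * M + 2 * Sω)) := mul_le_mul hD hD (norm_nonneg _) hD0
      _ = κ₁ ^ 2 * (a + 2 * M + 2 * Sω) ^ 2 := by ring
  have hD₂ := hU''b (ω + ψ)
  -- polynomial prefactors under one exponential `e^{2δΣω²}`
  have h1 : 1 ≤ exp (2 * δ * Sω) := one_le_exp (by positivity)
  have h8 := eight_sq_le hδ hSω0
  have hpoly : κ₂ + κ₁ ^ 2 * (a + 2 * M + 2 * Sω) ^ 2 ≤ (κ₂ + κ₁ ^ 2 * (2 * (a + 2 * M) ^ 2 + 4 * (δ ^ 2)⁻¹)) * exp (2 * δ * Sω) := by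
    have hsq' : (a + 2 * M + 2 * Sω) ^ 2 ≤ (2 * (a + 2 * M) ^ 2 + 4 * (δ ^ 2)⁻¹) * exp (2 * δ * Sω) := by
      have hsq : (a + 2 * M + 2 * Sω) ^ 2 ≤ 2 * (a + 2 * M) ^ 2 + 8 * Sω ^ 2 := by
        nlinarith [sq_nonneg (a + 2 * M - 2 * Sω)]
      have ha' : 2 * (a + 2 * M) ^ 2 ≤ 2 * (a + 2 * M) ^ 2 * exp (2 * δ * Sω) := le_mul_of_one_le_right (by positivity) h1
      nlinarith
    have hb : κ₂ ≤ κ₂ * exp (2 * δ * Sω) := le_mul_of_one_le_right hκ₂ h1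
    have hc : κ₁ ^ 2 * (a + 2 * M + 2 * Sω) ^ 2 ≤ κ₁ ^ 2 * ((2 * (a + 2 * M) ^ 2 + 4 * (δ ^ 2)⁻¹) * exp (2 * δ * Sω)) :=
      mul_le_mul_of_nonneg_left hsq' (sq_nonneg _)
    nlinarith
  -- assemble
  rw [norm_smul, Real.norm_eq_abs, abs_of_pos (exp_pos _)]
  have hK0 : 0 ≤ κ₂ + κ₁ ^ 2 * (2 * (a + 2 * M) ^ 2 + 4 * (δ ^ 2)⁻¹) := by positivity
  calc exp (-U (ω + ψ)) * ‖U'' (ω + ψ) - (U' (ω + ψ)).smulRight (U' (ω + ψ))‖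
      ≤ exp (κ₀ * (1 + τ) * Sω + κ₀ * (1 + τ⁻¹) * M) * ((κ₂ + κ₁ ^ 2 * (2 * (a + 2 * M) ^ 2 + 4 * (δ ^ 2)⁻¹)) * exp (2 * δ * Sω)) :=
        mul_le_mul (exp_le_exp.2 hV) (((norm_sub_le _ _).trans (add_le_add hD₂ hDD)).trans hpoly) (norm_nonneg _) (exp_pos _).le
    _ = exp (κ₀ * (1 + τ⁻¹) * M) * (κ₂ + κ₁ ^ 2 * (2 * (a + 2 * M) ^ 2 + 4 * (δ ^ 2)⁻¹)) *
          exp ((2 * κ₀ * (1 + τ) + 4 * δ) * Sω / 2) := by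
        have he : exp (κ₀ * (1 + τ) * Sω + κ₀ * (1 + τ⁻¹) * M) * exp (2 * δ * Sω) =
            exp (κ₀ * (1 + τ⁻¹) * M) * exp ((2 * κ₀ * (1 + τ) + 4 * δ) * Sω / 2) := by
          rw [← exp_add, ← exp_add]
          congr 1
          ring
        calc exp (κ₀ * (1 + τ) * Sω + κ₀ * (1 + τ⁻¹) * M) * ((κ₂ + κ₁ ^ 2 * (2 * (a + 2 * M) ^ 2 + 4 * (δ ^ 2)⁻¹)) * exp (2 * δ * Sω))
            = (κ₂ + κ₁ ^ 2 * (2 * (a + 2 * M) ^ 2 + 4 * (δ ^ 2)⁻¹)) * (exp (κ₀ * (1 + τ) * Sω + κ₀ * (1 + τ⁻¹) * M) * exp (2 * δ * Sω)) := by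
                ring
          _ = _ := by rw [he]; ring

/-! ## §2. THE END: the block effective action is twice differentiable -/

section TheEnd

variable {Γ : Matrix ι ι ℝ} {γop : ℝ} {U : EuclideanSpace ℝ ι → ℝ} {U' : EuclideanSpace ℝ ι → EuclideanSpace ℝ ι →L[ℝ] ℝ}
  {U'' : EuclideanSpace ℝ ι → EuclideanSpace ℝ ι →L[ℝ] EuclideanSpace ℝ ι →L[ℝ] ℝ} {κ₀ κ₁ κ₂ a τ δ θ : ℝ}

/-- **`d_ψZ = −G`**: the block step integral is differentiable with derivative `−∫e^{−U}•U′`. [folklore] -/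
theorem hasFDerivAt_block_step (hΓ : Γ.PosSemidef) (hΓop : (γop • (1 : Matrix ι ι ℝ) - Γ).PosSemidef) (Y : Finset ι)
    (hUd : ∀ φ : EuclideanSpace ℝ ι, HasFDerivAt U (U' φ) φ) (hU'c : Continuous U')
    (hκ₀ : 0 ≤ κ₀) (hκ₁ : 0 ≤ κ₁) (ha : 0 ≤ a) (hτ : 0 < τ) (hδ : 0 < δ) (hθ0 : 0 < θ) (hθ1 : θ < 1)
    (hκθ : (2 * κ₀ * (1 + τ) + 4 * δ) * γop ≤ θ) (hstab : ∀ φ : EuclideanSpace ℝ ι, -(κ₀ * ∑ x ∈ Y, φ x ^ 2) ≤ U φ)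
    (hU'b : ∀ φ : EuclideanSpace ℝ ι, ‖U' φ‖ ≤ κ₁ * (a + ∑ x ∈ Y, φ x ^ 2)) (ψ₀ : EuclideanSpace ℝ ι) :
    HasFDerivAt (fun ψ : EuclideanSpace ℝ ι => ∫ ω : EuclideanSpace ℝ ι, exp (-U (ω + ψ)) ∂(multivariateGaussian 0 Γ))
      (-∫ ω : EuclideanSpace ℝ ι, exp (-U (ω + ψ₀)) • U' (ω + ψ₀) ∂(multivariateGaussian 0 Γ)) ψ₀ := by
  have hUc : Continuous U := continuous_iff_continuousAt.2 fun φ => (hUd φ).continuousAt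
  have hUm : Measurable U := hUc.measurable
  have hκθ₀ : 2 * κ₀ * (1 + τ) * γop ≤ θ := mul_opBound_le_of_le (by positivity) (by linarith) hθ0.le hκθ
  have hI := integrable_exp_neg_block hΓ hΓop Y hUm hκ₀ hτ hθ1 hκθ₀ hstab ψ₀
  exact hasFDerivAt_fibreIntegral (μ := multivariateGaussian 0 Γ)
    (V := fun q : EuclideanSpace ℝ ι × EuclideanSpace ℝ ι => U (q.2 + q.1))
    (Vx := fun q : EuclideanSpace ℝ ι × EuclideanSpace ℝ ι => U' (q.2 + q.1))
    (x₀ := ψ₀) (U := closedBall ψ₀ 1) (closedBall_mem_nhds ψ₀ one_pos)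
    (fun ψ _ => (hUm.comp (measurable_id.add_const ψ)).aestronglyMeasurable) hI
    ((hU'c.comp (continuous_id.add continuous_const)).aestronglyMeasurable)
    (fun ψ _ ω => by
      have hlin : HasFDerivAt (fun ψ' : EuclideanSpace ℝ ι => ω + ψ') (ContinuousLinearMap.id ℝ (EuclideanSpace ℝ ι)) ψ :=
        (hasFDerivAt_id ψ).const_add ω
      have h := (hUd (ω + ψ)).comp ψ hlin
      rw [ContinuousLinearMap.comp_id] at h
      exact h)
    (integrable_domination hΓ hΓop Y hκ₀ hτ hδ hθ1 hκθ
      (κ₁ * exp (κ₀ * (1 + τ⁻¹) * (2 * ∑ x ∈ Y, ψ₀ x ^ 2 + 2)) * (a + 2 * (2 * ∑ x ∈ Y, ψ₀ x ^ 2 + 2) + δ⁻¹)))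
    (fun ψ hψ ω => by
      rw [mem_closedBall, dist_eq_norm] at hψ
      exact block_domination Y hκ₀ hκ₁ ha hτ hδ hstab hU'b ψ₀ ψ hψ ω)

/-- **THE TILTED NUMERATOR IS DIFFERENTIABLE**: under the three block letters, at EVERY `ψ₀`,
`HasFDerivAt (ψ ↦ ∫e^{−U(ω+ψ)}•U′(ω+ψ)dN(0,Γ)) (∫e^{−U(ω+ψ₀)}•(U″(ω+ψ₀) − U′(ω+ψ₀)⊗U′(ω+ψ₀))dN(0,Γ)) ψ₀`. [folklore] -/
theorem hasFDerivAt_block_tiltedNumerator (hΓ : Γ.PosSemidef) (hΓop : (γop • (1 : Matrix ι ι ℝ) - Γ).PosSemidef) (Y : Finset ι)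
    (hUd : ∀ φ : EuclideanSpace ℝ ι, HasFDerivAt U (U' φ) φ) (hU'd : ∀ φ : EuclideanSpace ℝ ι, HasFDerivAt U' (U'' φ) φ)
    (hU''c : Continuous U'') (hκ₀ : 0 ≤ κ₀) (hκ₁ : 0 ≤ κ₁) (ha : 0 ≤ a) (hκ₂ : 0 ≤ κ₂) (hτ : 0 < τ) (hδ : 0 < δ) (hθ1 : θ < 1)
    (hκθ : (2 * κ₀ * (1 + τ) + 4 * δ) * γop ≤ θ) (hstab : ∀ φ : EuclideanSpace ℝ ι, -(κ₀ * ∑ x ∈ Y, φ x ^ 2) ≤ U φ)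
    (hU'b : ∀ φ : EuclideanSpace ℝ ι, ‖U' φ‖ ≤ κ₁ * (a + ∑ x ∈ Y, φ x ^ 2)) (hU''b : ∀ φ : EuclideanSpace ℝ ι, ‖U'' φ‖ ≤ κ₂)
    (ψ₀ : EuclideanSpace ℝ ι) :
    HasFDerivAt (fun ψ : EuclideanSpace ℝ ι => ∫ ω : EuclideanSpace ℝ ι, exp (-U (ω + ψ)) • U' (ω + ψ) ∂(multivariateGaussian 0 Γ))
      (∫ ω : EuclideanSpace ℝ ι, exp (-U (ω + ψ₀)) • (U'' (ω + ψ₀) - (U' (ω + ψ₀)).smulRight (U' (ω + ψ₀)))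
        ∂(multivariateGaussian 0 Γ)) ψ₀ := by
  have hU'c : Continuous U' := continuous_iff_continuousAt.2 fun φ => (hU'd φ).continuousAt
  have hUc : Continuous U := continuous_iff_continuousAt.2 fun φ => (hUd φ).continuousAt
  have hFm : ∀ ψ : EuclideanSpace ℝ ι, AEStronglyMeasurable (fun ω : EuclideanSpace ℝ ι => exp (-U (ω + ψ)) • U' (ω + ψ))
      (multivariateGaussian 0 Γ) := fun ψ =>
    ((continuous_exp.comp (hUc.comp (continuous_id.add continuous_const)).neg).aestronglyMeasurable).smul
      ((hU'c.comp (continuous_id.add continuous_const)).aestronglyMeasurable)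
  have hF'm : AEStronglyMeasurable (fun ω : EuclideanSpace ℝ ι => exp (-U (ω + ψ₀)) •
      (U'' (ω + ψ₀) - (U' (ω + ψ₀)).smulRight (U' (ω + ψ₀)))) (multivariateGaussian 0 Γ) := by
    refine ((continuous_exp.comp (hUc.comp (continuous_id.add continuous_const)).neg).aestronglyMeasurable).smul ?_
    refine ((hU''c.comp (continuous_id.add continuous_const)).aestronglyMeasurable).sub ?_
    have hD : AEStronglyMeasurable (fun ω : EuclideanSpace ℝ ι => U' (ω + ψ₀)) (multivariateGaussian 0 Γ) :=
      (hU'c.comp (continuous_id.add continuous_const)).aestronglyMeasurable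
    exact isBoundedBilinearMap_smulRight.continuous.comp_aestronglyMeasurable (hD.prodMk hD)
  exact hasFDerivAt_integral_of_dominated_of_fderiv_le (μ := multivariateGaussian 0 Γ) (x₀ := ψ₀) (s := closedBall ψ₀ 1)
    (closedBall_mem_nhds ψ₀ one_pos) (Eventually.of_forall hFm)
    (integrable_weighted_blockDeriv hΓ hΓop Y hUd hU'c hκ₀ hκ₁ ha hτ hδ hθ1 hκθ hstab hU'b ψ₀) hF'm
    (Eventually.of_forall fun ω ψ hψ => by
      rw [mem_closedBall, dist_eq_norm] at hψ
      exact block_second_domination Y hκ₀ hκ₁ ha hκ₂ hτ hδ hstab hU'b hU''b ψ₀ ψ hψ ω)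
    (integrable_domination hΓ hΓop Y hκ₀ hτ hδ hθ1 hκθ
      (exp (κ₀ * (1 + τ⁻¹) * (2 * ∑ x ∈ Y, ψ₀ x ^ 2 + 2)) *
        (κ₂ + κ₁ ^ 2 * (2 * (a + 2 * (2 * ∑ x ∈ Y, ψ₀ x ^ 2 + 2)) ^ 2 + 4 * (δ ^ 2)⁻¹))))
    (Eventually.of_forall fun ω ψ _ => hasFDerivAt_weightedBlockDeriv hUd hU'd ω ψ)

/-- **THE END — THE EFFECTIVE ACTION OF A BLOCK-LOCAL INPUT IS TWICE DIFFERENTIABLE AT EVERY EXTERNAL FIELD.**  Under the three block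
letters (`U ∈ C²`, `U″` continuous) and the regulator margin with `0 < θ`, at EVERY `ψ₀`, with `Z = Z(ψ₀)`, `G = ∫e^{−U(ω+ψ₀)}•U′(ω+ψ₀)dμ`:
`HasFDerivAt (ψ ↦ fderiv ℝ (−log Z) ψ) (Z⁻¹ • ∫e^{−U}•(U″ − U′⊗U′)dμ + ((Z²)⁻¹•G)⊗G) ψ₀`. [folklore] -/
theorem hasFDerivAt_fderiv_block_neg_log (hΓ : Γ.PosSemidef) (hΓop : (γop • (1 : Matrix ι ι ℝ) - Γ).PosSemidef) (Y : Finset ι)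
    (hUd : ∀ φ : EuclideanSpace ℝ ι, HasFDerivAt U (U' φ) φ) (hU'd : ∀ φ : EuclideanSpace ℝ ι, HasFDerivAt U' (U'' φ) φ)
    (hU''c : Continuous U'') (hκ₀ : 0 ≤ κ₀) (hκ₁ : 0 ≤ κ₁) (ha : 0 ≤ a) (hκ₂ : 0 ≤ κ₂) (hτ : 0 < τ) (hδ : 0 < δ) (hθ0 : 0 < θ)
    (hθ1 : θ < 1) (hκθ : (2 * κ₀ * (1 + τ) + 4 * δ) * γop ≤ θ) (hstab : ∀ φ : EuclideanSpace ℝ ι, -(κ₀ * ∑ x ∈ Y, φ x ^ 2) ≤ U φ)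
    (hU'b : ∀ φ : EuclideanSpace ℝ ι, ‖U' φ‖ ≤ κ₁ * (a + ∑ x ∈ Y, φ x ^ 2)) (hU''b : ∀ φ : EuclideanSpace ℝ ι, ‖U'' φ‖ ≤ κ₂)
    (ψ₀ : EuclideanSpace ℝ ι) :
    HasFDerivAt (fun ψ : EuclideanSpace ℝ ι => fderiv ℝ (fun φ : EuclideanSpace ℝ ι =>
        -log (∫ ω : EuclideanSpace ℝ ι, exp (-U (ω + φ)) ∂(multivariateGaussian 0 Γ))) ψ)
      ((∫ ω : EuclideanSpace ℝ ι, exp (-U (ω + ψ₀)) ∂(multivariateGaussian 0 Γ))⁻¹ •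
          (∫ ω : EuclideanSpace ℝ ι, exp (-U (ω + ψ₀)) • (U'' (ω + ψ₀) - (U' (ω + ψ₀)).smulRight (U' (ω + ψ₀)))
            ∂(multivariateGaussian 0 Γ)) +
        (((∫ ω : EuclideanSpace ℝ ι, exp (-U (ω + ψ₀)) ∂(multivariateGaussian 0 Γ)) ^ 2)⁻¹ •
          ∫ ω : EuclideanSpace ℝ ι, exp (-U (ω + ψ₀)) • U' (ω + ψ₀) ∂(multivariateGaussian 0 Γ)).smulRight
          (∫ ω : EuclideanSpace ℝ ι, exp (-U (ω + ψ₀)) • U' (ω + ψ₀) ∂(multivariateGaussian 0 Γ))) ψ₀ := by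
  have hU'c : Continuous U' := continuous_iff_continuousAt.2 fun φ => (hU'd φ).continuousAt
  have hUc : Continuous U := continuous_iff_continuousAt.2 fun φ => (hUd φ).continuousAt
  have hUm : Measurable U := hUc.measurable
  have hκθ₀ : 2 * κ₀ * (1 + τ) * γop ≤ θ := mul_opBound_le_of_le (by positivity) (by linarith) hθ0.le hκθ
  -- the gradient map IS `ψ ↦ Z(ψ)⁻¹ • G(ψ)` (by (399) at every `ψ`)
  have hgrad : (fun ψ : EuclideanSpace ℝ ι => fderiv ℝ (fun φ : EuclideanSpace ℝ ι =>
      -log (∫ ω : EuclideanSpace ℝ ι, exp (-U (ω + φ)) ∂(multivariateGaussian 0 Γ))) ψ) =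
      fun ψ : EuclideanSpace ℝ ι => (∫ ω : EuclideanSpace ℝ ι, exp (-U (ω + ψ)) ∂(multivariateGaussian 0 Γ))⁻¹ •
        ∫ ω : EuclideanSpace ℝ ι, exp (-U (ω + ψ)) • U' (ω + ψ) ∂(multivariateGaussian 0 Γ) :=
    funext fun ψ => (hasFDerivAt_block_neg_log hΓ hΓop Y hUd hU'c hκ₀ hκ₁ ha hτ hδ hθ0 hθ1 hκθ hstab hU'b ψ).fderiv
  rw [hgrad]
  have hI := integrable_exp_neg_block hΓ hΓop Y hUm hκ₀ hτ hθ1 hκθ₀ hstab ψ₀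
  have hZ : 0 < ∫ ω : EuclideanSpace ℝ ι, exp (-U (ω + ψ₀)) ∂(multivariateGaussian 0 Γ) := integral_exp_pos hI
  have hZd := hasFDerivAt_block_step hΓ hΓop Y hUd hU'c hκ₀ hκ₁ ha hτ hδ hθ0 hθ1 hκθ hstab hU'b ψ₀
  have hZinv := (hasDerivAt_inv hZ.ne').comp_hasFDerivAt ψ₀ hZd
  have hG := hasFDerivAt_block_tiltedNumerator hΓ hΓop Y hUd hU'd hU''c hκ₀ hκ₁ ha hκ₂ hτ hδ hθ1 hκθ hstab hU'b hU''b ψ₀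
  refine (hZinv.smul hG).congr_fderiv ?_
  simp only [Function.comp_apply, smul_neg, neg_smul, neg_neg]

end TheEnd

/-! ## §3. Toy -/

/-- Toy (§1): with `δ = 1` and `S = 1`, `8 ≤ 4e²` (the prefactor lemma re-used). -/
example : 8 * (1 : ℝ) ^ 2 ≤ 4 * ((1 : ℝ) ^ 2)⁻¹ * exp (2 * 1 * 1) := eight_sq_le one_pos zero_le_one

end Summit.QuantumFields.BalabanUV.T4Continuum.NE7b.SupBlockEffectiveActionHessian
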